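import Summits.QuantumFields.BalabanUV.T4Continuum.Support.NE7QbarLipschitzOneLevel
import Summits.QuantumFields.BalabanUV.T4Continuum.Support.NE3HodgeCoexactPoincare
import HarnessLib

/-!
# NE7QbarLipschitzTower — THE `ℓ¹` LIPSCHITZ LETTER OF THE STRAIGHT (DOUBLE-BAR) TOWER IN THE BACKGROUND, k-UNIFORM:
# `Σ_{z∈[0,N)^d} Σ_κ ‖Q̄^{(j)}_W Y − Q^{(j)} Y‖ ≤ (Π_{i<j}(q + θ_i) − q^j)·‖Y‖_{ℓ¹([0,L^jN)^d)}`, `q = L∕L^d`, and, under the budget `Σ_i θ_i ≤ S·q`, `S ≤ 1`,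
# `≤ 2S·q^j·‖Y‖₁` — the letter (TT-Q) of the repaired test-field transport of (APE) (memo H15 §2), with `q^j = (L^j)^{1−d} = M^{1−d}`

Cell `pub-balaban`, rung (B)+1 sub-cell t4, lineage `b2b-balaban-t4-ne7-p1`, generation 71 (CRUX PROVER NE7 #1); memo
`t4/b2b-balaban-t4-ne7-p1-g71/HUNT-H15-EXP-LANDED-TT-CURRENCY.md` §2.  File F50 (over F49b `NE7QbarLipschitzOneLevel` (the one-level letter
`sum_norm_Qbar_sub_Qcoarse_le` and the flat norm `sum_norm_Qcoarse_le`), leaf-04's `NE3TangentCovariantTower` (`QbarIter`, `QbarIter_succ`, `QbarIter_flat`,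
`cavgIter`), `NE3TangentCovariantStructure.Qbar_add_period`, `NE3TangentFlatStructure.Qcoarse_add_period`, `NE3HodgeCoexactPoincare.iterate_Qcoarse_sub`,
`AveragingDeficitFermat.isPeriodicCfg_cavg`).
WHY (memo H15 §1–§2).  The repaired transport `Y′ = Y + gaugeDir_Ũ λ − R_Ũ ψ`, `ψ = (Q̄^{(k+1)}_Ũ − Q^{(k+1)})Y`, costs `τ‖Y‖₁` with
`τ = a·C·M^{d−2}·‖ψ‖₁∕‖Y‖₁`; THIS FILE bounds `‖ψ‖₁` by a k-UNIFORM multiple of `M^{1−d}‖Y‖₁` (Grönwall over the levels, inner-first: `Q̄^{(j+1)}_W Y =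
Q̄^{(j)}_{cavg W}(Q̄_W Y)`, the one-level letter at the bottom level, linearity and the exact norm `q = L∕L^d` of the flat straight average for the rest), so
that `τ ∼ δ(α̂ + …)M⁻³` — the H14 currency.  The per-level sizes `θ_i` are the one-level letter's constants at the link radii `η_i` of `cavgIter i W` and
`η_{i+1}` of `cavgIter (i+1) W`; for `W = e^{A}` they are geometric in `i` (the assembly file supplies them from row NE3's `relIter` letters).
WHAT ([folklore]; 0 def, 0 sorry).
§1 `isPeriodicDir_cast_succ` (period bookkeeping), **`sum_norm_iterate_Qcoarse_le`** (`‖Q^{(j)}‖_{ℓ¹→ℓ¹} ≤ q^j` on the torus).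
§2 **`sum_norm_QbarIter_sub_flat_le`** — THE TOWER LETTER: `W` with period `L^j·N`, every `cavgIter i W` (`i ≤ j`) unitary with link radius `η_i ≥ 0`,
   `2(d+1)Lη_i ≤ 1∕32` (`i < j`), `Y` `(L^j·N)`-periodic:
   `Σ_{z∈[0,N)^d}Σ_κ ‖QbarIter L j W Y z κ − QbarIter L j 1 Y z κ‖ ≤ (Π_{i<j}(q + θ_i) − q^j)·dirL1 Y (periodBox (L^j·N))`,
   `θ_i = (2η_{i+1} + 2(d+1)Lη_i)·q + 2(d+1)Lη_i·Csup·d(2nbRad+1)^d`.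
§3 `prod_sub_pow_le_of_budget` (`Π_{i<j}(q+θ_i) − q^j ≤ 2S·q^j` if `Σθ_i ≤ Sq`, `0 ≤ S ≤ 1`), **`sum_norm_QbarIter_sub_flat_le_of_budget`** (the letter in
   the form the assembly consumes: `≤ 2S·q^j·‖Y‖₁`).
HONEST FRAMING (page 1): lattice kinematics of the straight averaging tower; the radii budget for `e^{A}`, the TT assembly and (APE) are NOT here; nothing of
Bałaban's asserted; NOT ONE-STEP, NOT NE7; spine 0∕9; finite T⁴ rung (B)+1 — NOT infinite volume, NOT mass gap, NOT Clay.  Continuum YM on T⁴ ⇐ BetaPertH ∧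
nine spine estimates (0/9 proved); BetaPertH ⇐ (D1) ∧ (D4) ∧ CAP+tail; G-an2-4 gates asym, D1 and NE2/3/4.
-/

set_option autoImplicit false

open scoped BigOperators Matrix.Norms.L2Operator
open NormedSpace Finset

namespace Summit.QuantumFields.BalabanUV.T4Continuum.NE7QbarLipschitzTower

open Literature.MathematicalPhysics.QuantumFieldTheory.Balaban1983to89
open B7Prop1Explicit B7Prop2Explicit MatrixLog UnitaryModel
open T4AveragingDeficitWall (IsUnitaryCfg dirL1)
open T4AveragingDeficitWallBoundary (IsPeriodicCfg periodBox)
open AveragingDeficitPeriodicCounting (IsPeriodicDir)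
open AveragingDeficitChartCalculus (cavg)
open AveragingDeficitMultiLevelPrep (cavgIter)
open AveragingDeficitFermat (isPeriodicCfg_cavg)
open BlockAveragePushDirSplit (flat)
open BlockAverageVaryHolo (nbRad)
open NE3TangentFlatStructure (Qcoarse Qcoarse_add_period)
open NE3TangentCovariantStructure (Qbar Qbar_add_period)
open NE3TangentCovariantTower (QbarIter QbarIter_succ QbarIter_flat)
open NE3HodgeCoexactPoincare (iterate_Qcoarse_sub)
open NE7QbarLipschitzOneLevel (sum_norm_Qbar_sub_Qcoarse_le sum_norm_Qcoarse_le)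

noncomputable section

variable {d : ℕ} {n : Type*} [Fintype n] [DecidableEq n]

/-! ## §1 Period bookkeeping and the flat tower norm -/

omit [Fintype n] [DecidableEq n] in
/-- An `(L^{j+1}·N)`-periodic direction field is `(L·(L^j·N))`-periodic (the cast spelled as the one-level letters want it). [folklore] -/
theorem isPeriodicDir_cast_succ {L j N : ℕ} {Y : Site d → Fin d → Matrix n n ℂ} (hY : IsPeriodicDir Y (((L ^ (j + 1) * N : ℕ) : ℤ))) :
    IsPeriodicDir Y ((L : ℤ) * ((L ^ j * N : ℕ) : ℤ)) := by
  have hcast : (((L ^ (j + 1) * N : ℕ) : ℤ)) = (L : ℤ) * ((L ^ j * N : ℕ) : ℤ) := by push_cast; ring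
  rw [← hcast]; exact hY

/-- The same for configurations. [folklore] -/
theorem isPeriodicCfg_cast_succ {L j N : ℕ} {W : Site d → Fin d → (Matrix n n ℂ)ˣ} (hW : IsPeriodicCfg W (((L ^ (j + 1) * N : ℕ) : ℤ))) :
    IsPeriodicCfg W ((L : ℤ) * ((L ^ j * N : ℕ) : ℤ)) := by
  have hcast : (((L ^ (j + 1) * N : ℕ) : ℤ)) = (L : ℤ) * ((L ^ j * N : ℕ) : ℤ) := by push_cast; ring
  rw [← hcast]; exact hW

/-- **`‖Q^{(j)}‖_{ℓ¹→ℓ¹} ≤ q^j` ON THE TORUS** (`q = L∕L^d`): for an `(L^j·N)`-periodic `Y`,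
`Σ_{z∈[0,N)^d}Σ_κ ‖(Qcoarse L)^[j] Y z κ‖ ≤ q^j·dirL1 Y (periodBox (L^j·N))` (F49b's one-level flat norm, iterated). [folklore] -/
theorem sum_norm_iterate_Qcoarse_le [Nonempty n] {L : ℕ} (hL : 1 ≤ L) :
    ∀ (j : ℕ) {N : ℕ}, 1 ≤ N → ∀ (Y : Site d → Fin d → Matrix n n ℂ), IsPeriodicDir Y (((L ^ j * N : ℕ) : ℤ)) →
      ∑ z ∈ periodBox N, ∑ κ : Fin d, ‖(Qcoarse L)^[j] Y z κ‖ ≤ ((L : ℝ) / (L : ℝ) ^ d) ^ j * dirL1 Y (periodBox (L ^ j * N))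
  | 0, N, _, Y, _ => by simp [dirL1]
  | j + 1, N, hN, Y, hY => by
      have hM : 1 ≤ L ^ j * N := Nat.one_le_iff_ne_zero.mpr (Nat.mul_ne_zero (pow_ne_zero _ (by omega)) (by omega))
      have hY' := isPeriodicDir_cast_succ hY
      have hQY : IsPeriodicDir (Qcoarse L Y) (((L ^ j * N : ℕ) : ℤ)) := fun z τ κ =>
        Qcoarse_add_period L Y (P := ((L ^ j * N : ℕ) : ℤ)) (fun y τ' μ => hY' y τ' μ) z τ κ
      have ih := sum_norm_iterate_Qcoarse_le hL j hN (Qcoarse L Y) hQY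
      have h1 := sum_norm_Qcoarse_le (d := d) (n := n) hL hM Y hY'
      have hLM : L * (L ^ j * N) = L ^ (j + 1) * N := by ring
      rw [hLM] at h1
      have hq0 : 0 ≤ (L : ℝ) / (L : ℝ) ^ d := by positivity
      rw [Function.iterate_succ_apply]
      calc ∑ z ∈ periodBox N, ∑ κ : Fin d, ‖(Qcoarse L)^[j] (Qcoarse L Y) z κ‖
          ≤ ((L : ℝ) / (L : ℝ) ^ d) ^ j * dirL1 (Qcoarse L Y) (periodBox (L ^ j * N)) := ih
        _ ≤ ((L : ℝ) / (L : ℝ) ^ d) ^ j * (((L : ℝ) / (L : ℝ) ^ d) * dirL1 Y (periodBox (L ^ (j + 1) * N))) :=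
            mul_le_mul_of_nonneg_left h1 (pow_nonneg hq0 j)
        _ = ((L : ℝ) / (L : ℝ) ^ d) ^ (j + 1) * dirL1 Y (periodBox (L ^ (j + 1) * N)) := by rw [pow_succ]; ring

/-! ## §2 THE TOWER LETTER (Grönwall over the levels, inner-first) -/

/-- **THE `ℓ¹` LIPSCHITZ LETTER OF THE DOUBLE-BAR TOWER, k-UNIFORM.**  `L, N ≥ 1`; `W` with period `L^j·N` such that every averaged background
`cavgIter L i W` (`i ≤ j`) is unitary with LINK radius `η_i ≥ 0` (`‖(cavgIter i W)(b) − 1‖ ≤ η_i`), `2(d+1)Lη_i ≤ 1∕32` for `i < j`; `Y` an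
`(L^j·N)`-periodic direction field.  Then, with `q = L∕L^d`, `K = Csup·d(2nbRad+1)^d`, `θ_i = (2η_{i+1} + 2(d+1)Lη_i)·q + 2(d+1)Lη_i·K`:

  `Σ_{z∈[0,N)^d} Σ_κ ‖QbarIter L j W Y z κ − QbarIter L j 1 Y z κ‖ ≤ (Π_{i<j}(q + θ_i) − q^j)·dirL1 Y (periodBox (L^j·N))`.

Induction inner-first: `Q̄^{(j+1)}_W Y = Q̄^{(j)}_{cavg W}(Q̄_W Y)` and `Q^{(j+1)}Y = Q^{(j)}(QY)`; the hypothesis at `cavg W` with the shifted radii bounds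
`Q̄^{(j)}_{cavg W}Z − Q^{(j)}Z`, `Z = Q̄_W Y` with `‖Z‖₁ ≤ (q + θ₀)‖Y‖₁` (F49b); `Q^{(j)}(Z − QY)` costs `q^j·θ₀‖Y‖₁` (linearity, §1, F49b); and
`(Π_{i≥1} − q^j)(q + θ₀) + q^jθ₀ = Π − q^{j+1}`. [folklore] -/
theorem sum_norm_QbarIter_sub_flat_le [Nonempty n] {L : ℕ} (hL : 1 ≤ L) :
    ∀ (j : ℕ) {N : ℕ}, 1 ≤ N → ∀ {W : Site d → Fin d → (Matrix n n ℂ)ˣ} (η : ℕ → ℝ),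
      IsPeriodicCfg W (((L ^ j * N : ℕ) : ℤ)) →
      (∀ i, i ≤ j → IsUnitaryCfg (cavgIter L i W)) →
      (∀ i, i ≤ j → ∀ (x : Site d) (μ : Fin d), ‖((cavgIter L i W x μ : (Matrix n n ℂ)ˣ) : Matrix n n ℂ) - 1‖ ≤ η i) →
      (∀ i, 0 ≤ η i) → (∀ i, i < j → 2 * ((d : ℝ) + 1) * L * η i ≤ 1 / 32) →
      ∀ (Y : Site d → Fin d → Matrix n n ℂ), IsPeriodicDir Y (((L ^ j * N : ℕ) : ℤ)) →
        ∑ z ∈ periodBox N, ∑ κ : Fin d, ‖QbarIter L j W Y z κ - QbarIter L j (flat (d := d) (n := n)) Y z κ‖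
          ≤ ((∏ i ∈ Finset.range j, ((L : ℝ) / (L : ℝ) ^ d
                + ((2 * η (i + 1) + 2 * (((d : ℝ) + 1) * L) * η i) * ((L : ℝ) / (L : ℝ) ^ d)
                  + (2 * ((d : ℝ) + 1) * L * η i)
                    * ((1250 * ((nbRad d L : ℝ) + L) + 8 * (d * L) + 2 * L) * (d * (2 * nbRad d L + 1) ^ d)))))
              - ((L : ℝ) / (L : ℝ) ^ d) ^ j)
            * dirL1 Y (periodBox (L ^ j * N))
  | 0, N, _, W, η, _, _, _, _, _, Y, _ => by simp [QbarIter]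
  | j + 1, N, hN, W, η, hWP, hWu, hrad, hη0, hsm, Y, hY => by
      -- abbreviations
      set q : ℝ := (L : ℝ) / (L : ℝ) ^ d with hq
      set K : ℝ := (1250 * ((nbRad d L : ℝ) + L) + 8 * (d * L) + 2 * L) * (d * (2 * nbRad d L + 1) ^ d) with hK
      set θ : ℕ → ℝ := fun i => (2 * η (i + 1) + 2 * (((d : ℝ) + 1) * L) * η i) * q + (2 * ((d : ℝ) + 1) * L * η i) * K with hθ
      have hq0 : 0 ≤ q := by rw [hq]; positivity
      have hK0 : 0 ≤ K := by rw [hK]; positivity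
      have hθ0 : ∀ i, 0 ≤ θ i := fun i => by
        simp only [hθ]
        have := hη0 i; have := hη0 (i + 1)
        positivity
      -- the data one level up
      have hM : 1 ≤ L ^ j * N := Nat.one_le_iff_ne_zero.mpr (Nat.mul_ne_zero (pow_ne_zero _ (by omega)) (by omega))
      have hY' := isPeriodicDir_cast_succ hY
      have hWP' := isPeriodicCfg_cast_succ hWP
      have hW₁P : IsPeriodicCfg (cavg L W) (((L ^ j * N : ℕ) : ℤ)) := isPeriodicCfg_cavg L (L ^ j * N) hWP'
      have hWu0 : IsUnitaryCfg W := hWu 0 (Nat.zero_le _)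
      have hWu' : ∀ i, i ≤ j → IsUnitaryCfg (cavgIter L i (cavg L W)) := fun i hi => hWu (i + 1) (by omega)
      have hrad' : ∀ i, i ≤ j → ∀ (x : Site d) (μ : Fin d),
          ‖((cavgIter L i (cavg L W) x μ : (Matrix n n ℂ)ˣ) : Matrix n n ℂ) - 1‖ ≤ η (i + 1) := fun i hi => hrad (i + 1) (by omega)
      have hη0' : ∀ i, 0 ≤ η (i + 1) := fun i => hη0 (i + 1)
      have hsm' : ∀ i, i < j → 2 * ((d : ℝ) + 1) * L * η (i + 1) ≤ 1 / 32 := fun i hi => hsm (i + 1) (by omega)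
      set Z : Site d → Fin d → Matrix n n ℂ := Qbar L W Y with hZ
      have hZP : IsPeriodicDir Z (((L ^ j * N : ℕ) : ℤ)) := fun z i κ => Qbar_add_period L hWP' hY' z i κ
      -- the induction hypothesis one level up
      have ih := sum_norm_QbarIter_sub_flat_le hL j hN (fun i => η (i + 1)) hW₁P hWu' hrad' hη0' hsm' Z hZP
      -- the one-level letters at the bottom level
      have hηb : ∀ (z : Site d) (κ : Fin d), ‖((cavg L W z κ : (Matrix n n ℂ)ˣ) : Matrix n n ℂ) - 1‖ ≤ η 1 :=
        fun z κ => hrad 1 (by omega) z κ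
      have h1 := sum_norm_Qbar_sub_Qcoarse_le (d := d) (n := n) hL hM hWu0 (hrad 0 (Nat.zero_le _)) (hη0 0) (hsm 0 (by omega)) hηb Y hY'
      have h2 := sum_norm_Qcoarse_le (d := d) (n := n) hL hM Y hY'
      have hLM : L * (L ^ j * N) = L ^ (j + 1) * N := by ring
      rw [hLM] at h1 h2
      set D : ℝ := dirL1 Y (periodBox (L ^ (j + 1) * N)) with hD
      have hD0 : 0 ≤ D := by rw [hD]; unfold dirL1; exact Finset.sum_nonneg fun _ _ => Finset.sum_nonneg fun _ _ => norm_nonneg _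
      -- h1 is `≤ θ 0 * D`
      have h1' : ∑ z ∈ periodBox (L ^ j * N), ∑ κ : Fin d, ‖Qbar L W Y z κ - Qcoarse L Y z κ‖ ≤ θ 0 * D := by
        simpa only [hθ, hq, hK, zero_add] using h1
      -- ‖Z‖₁ ≤ (q + θ 0)·D
      have hZ1 : dirL1 Z (periodBox (L ^ j * N)) ≤ (q + θ 0) * D := by
        unfold dirL1
        calc ∑ z ∈ periodBox (L ^ j * N), ∑ κ : Fin d, ‖Z z κ‖
            ≤ ∑ z ∈ periodBox (L ^ j * N), ∑ κ : Fin d, (‖Qbar L W Y z κ - Qcoarse L Y z κ‖ + ‖Qcoarse L Y z κ‖) :=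
              Finset.sum_le_sum fun z _ => Finset.sum_le_sum fun κ _ => by
                simp only [hZ]
                have := norm_add_le (Qbar L W Y z κ - Qcoarse L Y z κ) (Qcoarse L Y z κ)
                rwa [sub_add_cancel] at this
          _ = ∑ z ∈ periodBox (L ^ j * N), ∑ κ : Fin d, ‖Qbar L W Y z κ - Qcoarse L Y z κ‖
              + ∑ z ∈ periodBox (L ^ j * N), ∑ κ : Fin d, ‖Qcoarse L Y z κ‖ := by
              simp only [Finset.sum_add_distrib]
          _ ≤ θ 0 * D + q * D := add_le_add h1' h2
          _ = (q + θ 0) * D := by ring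
      -- the flat linear part: `Q^{(j)}(Z − QY)`
      set Δ : Site d → Fin d → Matrix n n ℂ := fun y μ => Z y μ - Qcoarse L Y y μ with hΔ
      have hQYP : IsPeriodicDir (Qcoarse L Y) (((L ^ j * N : ℕ) : ℤ)) := fun z τ κ =>
        Qcoarse_add_period L Y (P := ((L ^ j * N : ℕ) : ℤ)) (fun y τ' μ => hY' y τ' μ) z τ κ
      have hΔP : IsPeriodicDir Δ (((L ^ j * N : ℕ) : ℤ)) := fun z i κ => by
        simp only [hΔ, hZP z i κ, hQYP z i κ]
      have hlin := sum_norm_iterate_Qcoarse_le (d := d) (n := n) hL j hN Δ hΔP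
      have hΔ1 : dirL1 Δ (periodBox (L ^ j * N)) ≤ θ 0 * D := by
        unfold dirL1; simpa only [hΔ, hZ] using h1'
      have hlin' : ∑ z ∈ periodBox N, ∑ κ : Fin d, ‖(Qcoarse L)^[j] Z z κ - (Qcoarse L)^[j] (Qcoarse L Y) z κ‖ ≤ q ^ j * (θ 0 * D) := by
        have e : ∀ (z : Site d) (κ : Fin d), (Qcoarse L)^[j] Z z κ - (Qcoarse L)^[j] (Qcoarse L Y) z κ = (Qcoarse L)^[j] Δ z κ := by
          intro z κ
          have := congr_fun (congr_fun (iterate_Qcoarse_sub L j Z (Qcoarse L Y)) z) κ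
          simpa only [hΔ] using this.symm
        simp only [e]
        exact hlin.trans (mul_le_mul_of_nonneg_left hΔ1 (pow_nonneg hq0 j))
      -- rewrite the two towers
      have eW : QbarIter L (j + 1) W Y = QbarIter L j (cavg L W) Z := QbarIter_succ L j W Y
      have e1 : QbarIter L (j + 1) (flat (d := d) (n := n)) Y = (Qcoarse L)^[j] (Qcoarse L Y) := by
        rw [QbarIter_flat hL (j + 1) Y, Function.iterate_succ_apply]
      have e1' : QbarIter L j (flat (d := d) (n := n)) Z = (Qcoarse L)^[j] Z := QbarIter_flat hL j Z
      rw [eW, e1]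
      -- the IH constant is nonnegative
      have hIHc : 0 ≤ (∏ i ∈ Finset.range j, (q + θ (i + 1))) - q ^ j := by
        have h := Finset.prod_le_prod (s := Finset.range j) (f := fun _ => q) (g := fun i => q + θ (i + 1))
          (fun i _ => hq0) (fun i _ => by linarith [hθ0 (i + 1)])
        rw [Finset.prod_const, Finset.card_range] at h
        linarith
      -- the IH in abbreviated form
      have ih' : ∑ z ∈ periodBox N, ∑ κ : Fin d, ‖QbarIter L j (cavg L W) Z z κ - (Qcoarse L)^[j] Z z κ‖
          ≤ ((∏ i ∈ Finset.range j, (q + θ (i + 1))) - q ^ j) * dirL1 Z (periodBox (L ^ j * N)) := by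
        rw [← e1']
        simpa only [hθ, hq, hK] using ih
      -- split and sum
      have hsplit : ∀ (z : Site d) (κ : Fin d),
          ‖QbarIter L j (cavg L W) Z z κ - (Qcoarse L)^[j] (Qcoarse L Y) z κ‖
            ≤ ‖QbarIter L j (cavg L W) Z z κ - (Qcoarse L)^[j] Z z κ‖ + ‖(Qcoarse L)^[j] Z z κ - (Qcoarse L)^[j] (Qcoarse L Y) z κ‖ :=
        fun z κ => by
          have := norm_add_le (QbarIter L j (cavg L W) Z z κ - (Qcoarse L)^[j] Z z κ)
            ((Qcoarse L)^[j] Z z κ - (Qcoarse L)^[j] (Qcoarse L Y) z κ)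
          rwa [sub_add_sub_cancel] at this
      have hprod : ∏ i ∈ Finset.range (j + 1), (q + θ i) = (∏ i ∈ Finset.range j, (q + θ (i + 1))) * (q + θ 0) :=
        Finset.prod_range_succ' _ _
      calc ∑ z ∈ periodBox N, ∑ κ : Fin d, ‖QbarIter L j (cavg L W) Z z κ - (Qcoarse L)^[j] (Qcoarse L Y) z κ‖
          ≤ ∑ z ∈ periodBox N, ∑ κ : Fin d, (‖QbarIter L j (cavg L W) Z z κ - (Qcoarse L)^[j] Z z κ‖
              + ‖(Qcoarse L)^[j] Z z κ - (Qcoarse L)^[j] (Qcoarse L Y) z κ‖) :=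
            Finset.sum_le_sum fun z _ => Finset.sum_le_sum fun κ _ => hsplit z κ
        _ = ∑ z ∈ periodBox N, ∑ κ : Fin d, ‖QbarIter L j (cavg L W) Z z κ - (Qcoarse L)^[j] Z z κ‖
            + ∑ z ∈ periodBox N, ∑ κ : Fin d, ‖(Qcoarse L)^[j] Z z κ - (Qcoarse L)^[j] (Qcoarse L Y) z κ‖ := by
            simp only [Finset.sum_add_distrib]
        _ ≤ ((∏ i ∈ Finset.range j, (q + θ (i + 1))) - q ^ j) * dirL1 Z (periodBox (L ^ j * N)) + q ^ j * (θ 0 * D) :=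
            add_le_add ih' hlin'
        _ ≤ ((∏ i ∈ Finset.range j, (q + θ (i + 1))) - q ^ j) * ((q + θ 0) * D) + q ^ j * (θ 0 * D) :=
            add_le_add (mul_le_mul_of_nonneg_left hZ1 hIHc) le_rfl
        _ = ((∏ i ∈ Finset.range (j + 1), (q + θ i)) - q ^ (j + 1)) * D := by rw [hprod, pow_succ]; ring

/-! ## §3 The budget form -/

omit [Fintype n] [DecidableEq n] in
/-- **`Π_{i<j}(q + θ_i) − q^j ≤ 2S·q^j`** when `q > 0`, `θ_i ≥ 0`, `Σ_{i<j}θ_i ≤ S·q` and `S ≤ 1` (`1 + t ≤ e^t`, `e^S − 1 ≤ 2S`). [folklore] -/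
theorem prod_sub_pow_le_of_budget {q S : ℝ} (hq : 0 < q) {θ : ℕ → ℝ} (hθ : ∀ i, 0 ≤ θ i) (j : ℕ)
    (hS : ∑ i ∈ Finset.range j, θ i ≤ S * q) (hS1 : S ≤ 1) :
    (∏ i ∈ Finset.range j, (q + θ i)) - q ^ j ≤ 2 * S * q ^ j := by
  have hS0 : 0 ≤ S := by
    have h0 : 0 ≤ ∑ i ∈ Finset.range j, θ i := Finset.sum_nonneg fun i _ => hθ i
    nlinarith
  -- Π (q + θ_i) = q^j Π (1 + θ_i/q) ≤ q^j Π exp(θ_i/q) = q^j exp(Σθ_i/q) ≤ q^j e^S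
  have hfac : ∀ i, q + θ i = q * (1 + θ i / q) := fun i => by field_simp
  have h1 : ∏ i ∈ Finset.range j, (q + θ i) = q ^ j * ∏ i ∈ Finset.range j, (1 + θ i / q) := by
    rw [Finset.prod_congr rfl fun i _ => hfac i, Finset.prod_mul_distrib, Finset.prod_const, Finset.card_range]
  have h2 : ∏ i ∈ Finset.range j, (1 + θ i / q) ≤ Real.exp S := by
    calc ∏ i ∈ Finset.range j, (1 + θ i / q) ≤ ∏ i ∈ Finset.range j, Real.exp (θ i / q) :=
          Finset.prod_le_prod (fun i _ => by have := hθ i; positivity) (fun i _ => by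
            have := Real.add_one_le_exp (θ i / q); linarith)
      _ = Real.exp (∑ i ∈ Finset.range j, θ i / q) := (Real.exp_sum _ _).symm
      _ ≤ Real.exp S := by
          refine Real.exp_le_exp.mpr ?_
          rw [← Finset.sum_div, div_le_iff₀ hq]
          exact hS
  have h3 : Real.exp S - 1 ≤ 2 * S := by
    have hx1 : |S| ≤ 1 := abs_le.mpr ⟨by linarith, hS1⟩
    have h := Real.abs_exp_sub_one_sub_id_le hx1
    have h' : Real.exp S - 1 - S ≤ S ^ 2 := (le_abs_self _).trans h
    nlinarith
  have hqj : 0 ≤ q ^ j := pow_nonneg hq.le j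
  rw [h1]
  nlinarith [mul_le_mul_of_nonneg_left h2 hqj, mul_le_mul_of_nonneg_left h3 hqj]

/-- **THE TOWER LETTER IN BUDGET FORM** (what the TT assembly consumes): under the hypotheses of §2 and the budget
`Σ_{i<j} θ_i ≤ S·q`, `S ≤ 1` (`θ_i` as in §2, `q = L∕L^d`):
`Σ_{z∈[0,N)^d} Σ_κ ‖QbarIter L j W Y z κ − QbarIter L j 1 Y z κ‖ ≤ 2S·q^j·dirL1 Y (periodBox (L^j·N))` — with `q^j = M^{1−d}` (`M = L^j`) and, for
`W = e^{A}`, `S = O(α̂)` (geometric radii), this is memo H15's `Λ_Q = C(α̂)·M^{1−d}`. [folklore] -/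
theorem sum_norm_QbarIter_sub_flat_le_of_budget [Nonempty n] {L : ℕ} (hL : 1 ≤ L) (j : ℕ) {N : ℕ} (hN : 1 ≤ N)
    {W : Site d → Fin d → (Matrix n n ℂ)ˣ} (η : ℕ → ℝ) (hWP : IsPeriodicCfg W (((L ^ j * N : ℕ) : ℤ)))
    (hWu : ∀ i, i ≤ j → IsUnitaryCfg (cavgIter L i W))
    (hrad : ∀ i, i ≤ j → ∀ (x : Site d) (μ : Fin d), ‖((cavgIter L i W x μ : (Matrix n n ℂ)ˣ) : Matrix n n ℂ) - 1‖ ≤ η i)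
    (hη0 : ∀ i, 0 ≤ η i) (hsm : ∀ i, i < j → 2 * ((d : ℝ) + 1) * L * η i ≤ 1 / 32)
    {S : ℝ} (hS1 : S ≤ 1)
    (hS : ∑ i ∈ Finset.range j, ((2 * η (i + 1) + 2 * (((d : ℝ) + 1) * L) * η i) * ((L : ℝ) / (L : ℝ) ^ d)
        + (2 * ((d : ℝ) + 1) * L * η i) * ((1250 * ((nbRad d L : ℝ) + L) + 8 * (d * L) + 2 * L) * (d * (2 * nbRad d L + 1) ^ d)))
      ≤ S * ((L : ℝ) / (L : ℝ) ^ d))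
    (Y : Site d → Fin d → Matrix n n ℂ) (hY : IsPeriodicDir Y (((L ^ j * N : ℕ) : ℤ))) :
    ∑ z ∈ periodBox N, ∑ κ : Fin d, ‖QbarIter L j W Y z κ - QbarIter L j (flat (d := d) (n := n)) Y z κ‖
      ≤ 2 * S * ((L : ℝ) / (L : ℝ) ^ d) ^ j * dirL1 Y (periodBox (L ^ j * N)) := by
  have h := sum_norm_QbarIter_sub_flat_le (d := d) (n := n) hL j hN η hWP hWu hrad hη0 hsm Y hY
  have hq : 0 < (L : ℝ) / (L : ℝ) ^ d := by
    have hL0 : (0 : ℝ) < L := by exact_mod_cast (by omega : 0 < L)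
    positivity
  have hθ : ∀ i, 0 ≤ (2 * η (i + 1) + 2 * (((d : ℝ) + 1) * L) * η i) * ((L : ℝ) / (L : ℝ) ^ d)
      + (2 * ((d : ℝ) + 1) * L * η i) * ((1250 * ((nbRad d L : ℝ) + L) + 8 * (d * L) + 2 * L) * (d * (2 * nbRad d L + 1) ^ d)) :=
    fun i => by have := hη0 i; have := hη0 (i + 1); positivity
  have hb := prod_sub_pow_le_of_budget hq hθ j hS hS1
  have hD0 : 0 ≤ dirL1 Y (periodBox (L ^ j * N)) := by
    unfold dirL1; exact Finset.sum_nonneg fun _ _ => Finset.sum_nonneg fun _ _ => norm_nonneg _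
  exact h.trans (mul_le_mul_of_nonneg_right hb hD0)

end

end Summit.QuantumFields.BalabanUV.T4Continuum.NE7QbarLipschitzTower
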